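import Summits.Ventures.WeilGRH.TwistedGramCellCheckCK2Tail
import HarnessLib

/-!
# GRH arm: twisted format C for COMPLEX characters — checker `K` at TAIL ORDER `J = 2`, part 2/2: the CHECKER and the DOOR (second two-sided tail of `…_dataJ`)

Cell `rh-explicit`, WEIL TRACK — GRH ARM (engine seat weil-grh-2 gen15).  `TwistedGramCellCheckCK` instantiates the data door
`weilPositivityOnChar_of_twistedC_formatC_dataJ` at `J = 1`; this file instantiates it at `J = 2` with tail weights `λ = (1, r)`, `r = rN/rD`:
the diagonal tail term falls from `(2B−1)(4A′κ/π)²/(3d₀(B₃−1)³)` to `(2B−1)(4A′κ²/π)²/(5d₀(B₃−1)⁵)` at the price of the bracket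
`K₁₁ κ_i κ_{i′}` (signed modes) in the two rank-one parts (`K₀₀ = 1/(B₃−1) + r(1/(4(B₃−1)²) − 1/(4B₃²))`, `K₁₁ = 1/(3(B₃−1)³) + (1/(4(B₃−1)²) − 1/(4B₃²))/r`;
the `j ≠ j′` brackets cancel between the two copies of the tail).  Float sizing (weil-grh-2 gen15, sizeJ2.py): the last even complex primitive
class of conductor ≤ 20 without a `t = 1` cell, 7.2/7.4, has block margin 2.4e−4 and is NOT PD with the `J = 1` tail on the A1 table
(−1.3e−4 at (40,160)) but IS with `J = 2` (+1.6e−4, `r = 8`, `θ = 0.03`, `η = 1/2`).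
Contents (part 1 `TwistedGramCellCheckCK2Tail` has `uC2` / `uC2Real` / `mem_uC2`, the `J = 2` tail box and its soundness): `cellK2`, ★ `checkCellK2Block` (+ `_iff`, glue),
`mem_cellK2`, ★ `psd_of_checkCellK2`, ★★ `weilPositivityOnChar_of_checkCellK2` (door at `J = 2`, `λ = ![1, r]`; literal `hS` produced inside
the proof).  Everything proved; computable `def`s; RH/GRH-free.  References: H. Yoshida (1992) §§5–7 [Yoshida1992HermitianForms];
R. E. Moore (1966) Ch. 3 [Moore1966]; von zur Gathen–Gerhard (2013) §8.4 [vzGG2013].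
-/

set_option autoImplicit false
set_option linter.style.longLine false

open Real Complex Finset
open scoped BigOperators ArithmeticFunction.vonMangoldt ComplexConjugate

namespace Summit.Ventures.WeilGRH

open Literature.NumberTheory.LFunctions Literature.NumberTheory.LFunctions.Yoshida1992
open Literature.NumberTheory.LFunctions.Yoshida1992.Encl
open Literature.Analysis.SpecialFunctions Literature.Analysis.ValidatedNumerics.NumericsMP
open Kron

namespace TwistedEncl

variable {S : ℕ} {a : ℝ} {q : ℕ}

/-! ## The checker at `J = 2` -/

/-- The boxed cell entry `S(i,i′) = M − Schur − U₂`. [cite: Yoshida1992HermitianForms, §7 pp. 305–312] -/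
def cellK2 (S : ℕ) (C : Consts) (xs ys : List MI) (LQ : MI) (tab : List IdxRec) (d : CCellData) (e : CTailData) (f : K2TailData)
    (Bk : ℕ) (TX TY : List KFar) (i i' : ℕ) : MI :=
  ((entryC S C xs ys LQ tab i i').sub (schurK S Bk (2 * (d.B3 - d.B)) (TX.getD i default) (TY.getD i' default))).sub
    (uC2 S C xs ys tab d e f i i')

/-- ★ THE `J = 2` CHECKER on a block (rows `i₀ ≤ i < i₀+nr`, columns `j₀ ≤ i′ < j₀+nc`), as `checkCellKBlock` with the `J = 2` tail and the extra
positivity of `r`. [cite: Moore1966, Ch. 3 (interval arithmetic: inclusion property)] -/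
def checkCellK2Block (S : ℕ) (C : Consts) (xs ys : List MI) (LQ : MI) (tab : List IdxRec) (d : CCellData) (e : CTailData)
    (f : K2TailData) (c : ℕ) (ρ : ℤ) (D : List (List ℤ)) (i0 nr j0 nc : ℕ) : Bool :=
  let R := farRecs S C xs ys LQ tab d
  let Bk := 2 * (d.B3 - d.B) * (2 * KO) ^ 2
  (decide (0 < d.B3 - d.B) && decide (0 < f.rN) && decide (0 < f.rD)) &&
    (((List.range' i0 nr).all fun i ↦ (R.1.getD i default).ok) && ((List.range' j0 nc).all fun i' ↦ (R.2.getD i' default).ok)) &&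
    (List.range' i0 nr).all fun i ↦ (List.range' j0 nc).all fun i' ↦
      enclCheck S c ρ (PsdDyadic.getMZ D i i') (cellK2 S C xs ys LQ tab d e f Bk R.1 R.2 i i')

/-- The real cell entry at `J = 2`. [cite: Yoshida1992HermitianForms, §7 pp. 305–312] -/
noncomputable def cellK2Real (χ : DirichletCharacter ℂ q) (a : ℝ) (d : CCellData) (e : CTailData) (f : K2TailData) (i i' : ℕ) : ℝ :=
  (twistedGramCoeffC χ a (modeOfIdx i) (modeOfIdx i')).re
    - (∑ c ∈ Finset.range (2 * (d.B3 - d.B)),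
        (twistedGramCoeffC χ a (modeOfIdx i) (modeOfIdx (2 * d.B - 1 + c))).re *
          ((twistedGramCoeffC χ a (modeOfIdx i') (modeOfIdx (2 * d.B - 1 + c))).re * 2 ^ d.wbits / (d.wN.getD (c / 2) 0 : ℝ)))
    - uC2Real (∑ k ∈ weilPrimeIndex a, (ArithmeticFunction.vonMangoldt k : ℝ) / Real.sqrt k) (a * (1 + weilArchDensity (2 * a)))
        ((e.θN : ℝ) / e.θD) ((e.ηN : ℝ) / e.ηD) ((d.d0N : ℝ) / 2 ^ d.wbits) ((f.rN : ℝ) / f.rD) d.B d.B3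
        (fun i ↦ ((Complex.digamma (1 / 4 + ((freq a (modeOfIdx i) : ℝ) : ℂ) / 2 * Complex.I)).im / 2
          + (∑ k ∈ weilPrimeIndex a, (ArithmeticFunction.vonMangoldt k : ℝ) / Real.sqrt k *
              ((χ (k : ZMod q)).re * Real.sin (freq a (modeOfIdx i) * Real.log k) +
                (χ (k : ZMod q)).im * Real.cos (freq a (modeOfIdx i) * Real.log k)))
          - archExpSumSin a (modeOfIdx i)) / Real.pi) i i'

/-- ★ `cellK2 ∋ S(i,i′)`. [cite: Moore1966, Ch. 3 (interval arithmetic: inclusion property)] -/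
theorem mem_cellK2 (hS : 0 < S) (ha0 : 0 < a) {ks : List PrimeLen} (hks : PrimeData a ks) {C : Consts}
    (hC : ConstsValid S a ks C) (χ : DirichletCharacter ℂ q) {xs ys : List MI}
    (hx : ∀ i < ks.length, MI.mem S (χ (((ks.getD i default).val : ℕ) : ZMod q)).re (xs.getD i default))
    (hy : ∀ i < ks.length, MI.mem S (χ (((ks.getD i default).val : ℕ) : ZMod q)).im (ys.getD i default))
    {LQ : MI} (hLQ : MI.mem S (Real.log q) LQ) {N : ℕ} {tab : List IdxRec} (hT : TabValid S a ks N tab)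
    {d : CCellData} {e : CTailData} {f : K2TailData} (hN : d.B3 ≤ N) (hh : checkCellCHead d e = true) (hfar : 0 < d.B3 - d.B)
    (hrN : 0 < f.rN) (hrD : 0 < f.rD) (hCC : MI.mem S (a * (1 + weilArchDensity (2 * a))) d.CC)
    {i i' : ℕ} (hi : i < 2 * d.B - 1) (hi' : i' < 2 * d.B - 1)
    (hok1 : ((farRecs S C xs ys LQ tab d).1.getD i default).ok = true) (hok2 : ((farRecs S C xs ys LQ tab d).2.getD i' default).ok = true) :
    MI.mem S (cellK2Real χ a d e f i i')
      (cellK2 S C xs ys LQ tab d e f (2 * (d.B3 - d.B) * (2 * KO) ^ 2) (farRecs S C xs ys LQ tab d).1 (farRecs S C xs ys LQ tab d).2 i i') := by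
  obtain ⟨⟨hB2, hBB3⟩, ⟨hθN, hθD, hηN, hηD⟩, hd0, hw⟩ := checkCellCHead_specK hh
  have hiN : i < 2 * N - 1 := by omega
  have hi'N : i' < 2 * N - 1 := by omega
  have hTX := farRecs_fst_getD S C xs ys LQ tab d hi
  have hTY := farRecs_snd_getD S C xs ys LQ tab d hi'
  have hXok := hok1
  have hYok := hok2
  rw [hTX] at hXok
  rw [hTY] at hYok
  unfold cellK2 cellK2Real
  rw [hTX, hTY]
  refine MI.mem_sub (MI.mem_sub (mem_entryC hS ha0 hks hC χ hx hy hLQ hT hiN hi'N) ?_)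
    (mem_uC2 hS hks hC χ hx hy hT hθN hθD hηN hηD hd0 (by omega) hrN hrD hCC hiN hi'N)
  refine mem_schurK hS (length_farRowK S C xs ys LQ tab d.B i 0 _)
    (by rw [length_scaleRowK, length_farRowK]) (by omega) le_rfl hXok hYok ?_ ?_
  · intro c hc
    rw [getD_farRowK S C xs ys LQ tab d.B i 0 _ c hc, zero_add]
    exact mem_entryC hS ha0 hks hC χ hx hy hLQ hT hiN (by omega)
  · intro c hc
    rw [getD_scaleRowK d.wbits d.wN _ 0 c (by rw [length_farRowK]; exact hc), getD_farRowK S C xs ys LQ tab d.B i' 0 _ c hc]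
    simp only [zero_add]
    have hwc : 0 < d.wN.getD (c / 2) 0 := hw (c / 2) (by omega)
    have h := MI.mem_divNat (MI.mem_mulInt (mem_entryC hS ha0 hks hC χ hx hy hLQ hT hi'N (by omega : 2 * d.B - 1 + c < 2 * N - 1))
      ((2 : ℤ) ^ d.wbits)) hwc
    refine mem_of_eq h ?_
    push_cast; ring

/-- Semantics of the `J = 2` block checker. [cite: Moore1966, Ch. 3 (interval arithmetic: inclusion property)] -/
theorem checkCellK2Block_iff {C : Consts} {xs ys : List MI} {LQ : MI} {tab : List IdxRec} {d : CCellData} {e : CTailData}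
    {f : K2TailData} {c : ℕ} {ρ : ℤ} {D : List (List ℤ)} {i0 nr j0 nc : ℕ} :
    checkCellK2Block S C xs ys LQ tab d e f c ρ D i0 nr j0 nc = true ↔
      (0 < d.B3 - d.B ∧ 0 < f.rN ∧ 0 < f.rD) ∧
      ((∀ i, i0 ≤ i → i < i0 + nr → ((farRecs S C xs ys LQ tab d).1.getD i default).ok = true) ∧
        (∀ i', j0 ≤ i' → i' < j0 + nc → ((farRecs S C xs ys LQ tab d).2.getD i' default).ok = true)) ∧
      ∀ i, i0 ≤ i → i < i0 + nr → ∀ i', j0 ≤ i' → i' < j0 + nc → enclCheck S c ρ (PsdDyadic.getMZ D i i')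
        (cellK2 S C xs ys LQ tab d e f (2 * (d.B3 - d.B) * (2 * KO) ^ 2)
          (farRecs S C xs ys LQ tab d).1 (farRecs S C xs ys LQ tab d).2 i i') = true := by
  unfold checkCellK2Block
  simp only [Bool.and_eq_true, decide_eq_true_eq, List.all_eq_true, List.mem_range'_1, and_imp, and_assoc]

/-- Row glue at `J = 2`. [folklore] -/
theorem checkCellK2Block_glueRows {C : Consts} {xs ys : List MI} {LQ : MI} {tab : List IdxRec} {d : CCellData} {e : CTailData}
    {f : K2TailData} {c : ℕ} {ρ : ℤ} {D : List (List ℤ)} {i0 n1 i1 n2 n j0 nc : ℕ}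
    (h1 : checkCellK2Block S C xs ys LQ tab d e f c ρ D i0 n1 j0 nc = true)
    (h2 : checkCellK2Block S C xs ys LQ tab d e f c ρ D i1 n2 j0 nc = true)
    (hi : i1 = i0 + n1) (hn : n = n1 + n2) : checkCellK2Block S C xs ys LQ tab d e f c ρ D i0 n j0 nc = true := by
  subst hi hn
  rw [checkCellK2Block_iff] at h1 h2 ⊢
  refine ⟨h1.1, ⟨fun i hi1 hi2 ↦ ?_, h1.2.1.2⟩, fun i hi1 hi2 i' hj1 hj2 ↦ ?_⟩
  · by_cases h : i < i0 + n1
    · exact h1.2.1.1 i hi1 h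
    · exact h2.2.1.1 i (by omega) (by omega)
  · by_cases h : i < i0 + n1
    · exact h1.2.2 i hi1 h i' hj1 hj2
    · exact h2.2.2 i (by omega) (by omega) i' hj1 hj2

/-- Column glue at `J = 2`. [folklore] -/
theorem checkCellK2Block_glueCols {C : Consts} {xs ys : List MI} {LQ : MI} {tab : List IdxRec} {d : CCellData} {e : CTailData}
    {f : K2TailData} {c : ℕ} {ρ : ℤ} {D : List (List ℤ)} {i0 nr j0 c1 j1 c2 nc : ℕ}
    (h1 : checkCellK2Block S C xs ys LQ tab d e f c ρ D i0 nr j0 c1 = true)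
    (h2 : checkCellK2Block S C xs ys LQ tab d e f c ρ D i0 nr j1 c2 = true)
    (hj : j1 = j0 + c1) (hn : nc = c1 + c2) : checkCellK2Block S C xs ys LQ tab d e f c ρ D i0 nr j0 nc = true := by
  subst hj hn
  rw [checkCellK2Block_iff] at h1 h2 ⊢
  refine ⟨h1.1, ⟨h1.2.1.1, fun i' hj1 hj2 ↦ ?_⟩, fun i hi1 hi2 i' hj1 hj2 ↦ ?_⟩
  · by_cases h : i' < j0 + c1
    · exact h1.2.1.2 i' hj1 h
    · exact h2.2.1.2 i' (by omega) (by omega)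
  · by_cases h : i' < j0 + c1
    · exact h1.2.2 i hi1 hi2 i' hj1 h
    · exact h2.2.2 i hi1 hi2 i' (by omega) (by omega)

/-- ★ **The PSD fact of the cell at `J = 2` (clean form).** [cite: Yoshida1992HermitianForms, §7 pp. 305–312] -/
theorem psd_of_checkCellK2 (hS : 0 < S) (ha0 : 0 < a) {ks : List PrimeLen} (hks : PrimeData a ks) {C : Consts}
    (hC : ConstsValid S a ks C) (χ : DirichletCharacter ℂ q) {xs ys : List MI}
    (hx : ∀ i < ks.length, MI.mem S (χ (((ks.getD i default).val : ℕ) : ZMod q)).re (xs.getD i default))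
    (hy : ∀ i < ks.length, MI.mem S (χ (((ks.getD i default).val : ℕ) : ZMod q)).im (ys.getD i default))
    {LQ : MI} (hLQ : MI.mem S (Real.log q) LQ) {N : ℕ} {tab : List IdxRec} (hT : TabValid S a ks N tab)
    {d : CCellData} {e : CTailData} {f : K2TailData} (hN : d.B3 ≤ N) (hCC : MI.mem S (a * (1 + weilArchDensity (2 * a))) d.CC)
    {c : ℕ} {ρ δ : ℤ} {D L : List (List ℤ)} (hh : checkCellCHead d e = true)
    (hrows : checkCellK2Block S C xs ys LQ tab d e f c ρ D 0 (2 * d.B - 1) 0 (2 * d.B - 1) = true)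
    (hpsd : PsdDyadic.checkPsdMid (2 * d.B - 1) δ ρ D L = true) :
    ∀ x : Fin (2 * d.B - 1) → ℝ, 0 ≤ ∑ i, ∑ i', x i * x i' * cellK2Real χ a d e f i i' := by
  obtain ⟨⟨hfar, hrN, hrD⟩, ⟨hok1, hok2⟩, hr⟩ := checkCellK2Block_iff.mp hrows
  have hnear : ∀ i i' : Fin (2 * d.B - 1), |cellK2Real χ a d e f i i' - (PsdDyadic.getMZ D i i' : ℝ) * (1 / 2 ^ c)| ≤ (ρ : ℝ) * (1 / 2 ^ c) :=
    fun i i' ↦ abs_sub_le_of_enclCheck hS (hr i (Nat.zero_le _) (by simp [i.isLt]) i' (Nat.zero_le _) (by simp [i'.isLt]))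
      (mem_cellK2 hS ha0 hks hC χ hx hy hLQ hT hN hh hfar hrN hrD hCC i.isLt i'.isLt
        (hok1 i (Nat.zero_le _) (by simp [i.isLt])) (hok2 i' (Nat.zero_le _) (by simp [i'.isLt])))
  exact PsdDyadic.psd_of_checkPsdMid hpsd (u := 1 / 2 ^ c) (by positivity) (fun i i' ↦ cellK2Real χ a d e f i i') hnear

set_option maxHeartbeats 1600000 in
set_option maxRecDepth 8192 in
/-- ★★ **Front door of the complex χ-cell lane at tail order `J = 2`** (weights `λ = (1, rN/rD)`); hypotheses as in
`weilPositivityOnChar_of_checkCellK` with `checkCellK2Block` ⇒ `WeilPositivityOnChar χ a`. [cite: Yoshida1992HermitianForms, §7 pp. 305–312] -/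
theorem weilPositivityOnChar_of_checkCellK2 (hq : q ≠ 1) (hS : 0 < S) (ha0 : 0 < a) {Karc : ℕ} {ks : List PrimeLen}
    (hks : PrimeData a ks) {C : Consts} (hC : ConstsValid S a ks C) (χ : DirichletCharacter ℂ q) {xs ys : List MI}
    (hx : ∀ i < ks.length, MI.mem S (χ (((ks.getD i default).val : ℕ) : ZMod q)).re (xs.getD i default))
    (hy : ∀ i < ks.length, MI.mem S (χ (((ks.getD i default).val : ℕ) : ZMod q)).im (ys.getD i default))
    {LQ : MI} (hLQ : MI.mem S (Real.log q) LQ) {N : ℕ} {tab : List IdxRec} (hT : TabValid S a ks N tab)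
    {d : CCellData} {e : CTailData} {f : K2TailData} (hN : d.B3 < N) (hCC : MI.mem S (a * (1 + weilArchDensity (2 * a))) d.CC)
    (hAOP : MI.mem S (∑ k ∈ weilPrimeIndex a, (Λ k : ℝ) / Real.sqrt k * (2 * Real.cos (π / (⌊2 * a / Real.log k⌋₊ + 2)))) d.AOP)
    (hsg : checkSignsC S Karc C LQ tab d = true)
    {c : ℕ} {ρ δ : ℤ} {D L : List (List ℤ)} (hh : checkCellCHead d e = true)
    (hrows : checkCellK2Block S C xs ys LQ tab d e f c ρ D 0 (2 * d.B - 1) 0 (2 * d.B - 1) = true)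
    (hpsd : PsdDyadic.checkPsdMid (2 * d.B - 1) δ ρ D L = true) :
    WeilPositivityOnChar χ a := by
  obtain ⟨⟨hB2, hBB3⟩, ⟨hθN, hθD, hηN, hηD⟩, -, -⟩ := checkCellCHead_specK hh
  obtain ⟨⟨-, hrN, hrD⟩, -, -⟩ := checkCellK2Block_iff.mp hrows
  obtain ⟨h0, hd0, hw⟩ := signsC_of_checkSignsC hS ha0 hC hLQ hT hN hCC hAOP hsg
  have key := psd_of_checkCellK2 hS ha0 hks hC χ hx hy hLQ hT hN.le hCC hh hrows hpsd
  have hiota : ∀ p : ℤ, modeOfIdx (if 0 < p then 2 * p.natAbs - 1 else 2 * p.natAbs) = p := by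
    intro p
    unfold modeOfIdx
    obtain ⟨n, rfl | rfl⟩ := Int.eq_nat_or_neg p
    · by_cases hn : n = 0
      · subst hn; simp
      · have hp : (0 : ℤ) < (n : ℤ) := by omega
        rw [if_pos hp, Int.natAbs_natCast]
        have h1 : (2 * n - 1) % 2 = 1 := by omega
        rw [if_pos h1]
        have h2 : (2 * n - 1 + 1) / 2 = n := by omega
        rw [h2]
    · have hp : ¬ (0 : ℤ) < -(n : ℤ) := by omega
      rw [if_neg hp, Int.natAbs_neg, Int.natAbs_natCast]
      have h1 : ¬ (2 * n) % 2 = 1 := by omega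
      rw [if_neg h1]
      have h2 : 2 * n / 2 = n := by omega
      rw [h2]
  have hsgn : ∀ i : ℕ, (-1 : ℝ) ^ (if i % 2 = 1 then (((i + 1) / 2 : ℕ) : ℤ) else -(((i / 2 : ℕ)) : ℤ)) = ((sgnOfIdx i : ℤ) : ℝ) := by
    intro i
    have e1 : (if i % 2 = 1 then (((i + 1) / 2 : ℕ) : ℤ) else -(((i / 2 : ℕ)) : ℤ)) = modeOfIdx i := rfl
    rw [e1]
    unfold sgnOfIdx
    by_cases h : (modeOfIdx i).natAbs % 2 = 0
    · rw [if_pos h, (Int.natAbs_even.mp (Nat.even_iff.mpr h)).neg_one_zpow]; push_cast; rfl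
    · rw [if_neg h, (Int.natAbs_odd.mp (Nat.odd_iff.mpr (by omega))).neg_one_zpow]; push_cast; rfl
  have hr0 : (0 : ℝ) < (f.rN : ℝ) / f.rD := div_pos (Nat.cast_pos.mpr hrN) (Nat.cast_pos.mpr hrD)
  refine weilPositivityOnChar_of_twistedC_formatC_dataJ hq χ ha0
    (fun i i' ↦ (twistedGramCoeffC χ a (modeOfIdx i) (modeOfIdx i')).re)
    (fun j j' ↦ congrArg Complex.re (twistedGramCoeffC_comm χ a _ _))
    (fun p p' ↦ by simp only [hiota]) hB2 hBB3 2 ![1, (f.rN : ℝ) / f.rD]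
    (fun j ↦ by fin_cases j <;> simp [hr0])
    (θ := (e.θN : ℝ) / e.θD) (η := (e.ηN : ℝ) / e.ηD) (d₀ := (d.d0N : ℝ) / 2 ^ d.wbits)
    (div_pos (Nat.cast_pos.mpr hθN) (Nat.cast_pos.mpr hθD)) (div_pos (Nat.cast_pos.mpr hηN) (Nat.cast_pos.mpr hηD))
    (fun j ↦ (d.wN.getD ((j + 1) / 2 - d.B) 0 : ℝ) / 2 ^ d.wbits) h0 hd0 hw ?_
  intro x
  refine (key x).trans_eq (Finset.sum_congr rfl fun i _ ↦ Finset.sum_congr rfl fun i' _ ↦ ?_)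
  congr 1
  have hIco : ∀ (g : ℕ → ℝ), ∑ j ∈ Finset.Ico (2 * d.B - 1) (2 * d.B3 - 1), g j =
      ∑ c' ∈ Finset.range (2 * (d.B3 - d.B)), g (2 * d.B - 1 + c') := by
    intro g
    rw [Finset.sum_Ico_eq_sum_range, show 2 * d.B3 - 1 - (2 * d.B - 1) = 2 * (d.B3 - d.B) by omega]
  have hwIdx : ∀ c' : ℕ, (2 * d.B - 1 + c' + 1) / 2 - d.B = c' / 2 := fun c' ↦ by omega
  rw [hIco]
  simp only [hwIdx, Matrix.of_apply]
  unfold cellK2Real uC2Real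
  have hsch : ∀ (u v w : ℕ → ℝ), (∑ c ∈ Finset.range (2 * (d.B3 - d.B)), u c * (v c * 2 ^ d.wbits / w c)) =
      ∑ c ∈ Finset.range (2 * (d.B3 - d.B)), u c * v c / (w c / 2 ^ d.wbits) := fun u v w ↦
    Finset.sum_congr rfl fun c _ ↦ by rw [div_div_eq_mul_div]; ring
  rw [hsch]
  have hθ0 : (e.θD : ℝ) ≠ 0 := by exact_mod_cast hθD.ne'
  have hη0 : (e.ηD : ℝ) ≠ 0 := by exact_mod_cast hηD.ne'
  have hηN0 : (e.ηN : ℝ) ≠ 0 := by exact_mod_cast hηN.ne'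
  have hθN0 : (e.θN : ℝ) ≠ 0 := by exact_mod_cast hθN.ne'
  have hrN0 : (f.rN : ℝ) ≠ 0 := by exact_mod_cast hrN.ne'
  have hrD0 : (f.rD : ℝ) ≠ 0 := by exact_mod_cast hrD.ne'
  have hB31 : ((d.B3 - 1 : ℕ) : ℝ) ≠ 0 := by exact_mod_cast (show d.B3 - 1 ≠ 0 by omega)
  have hB30 : (d.B3 : ℝ) ≠ 0 := by exact_mod_cast (show d.B3 ≠ 0 by omega)
  have hd00 : (d.d0N : ℝ) ≠ 0 := by
    have := hd0.1; intro h; rw [h, zero_div] at this; exact lt_irrefl _ this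
  have f01 : ((0 : Fin 2) = 1) = False := eq_false (by decide)
  have f10 : ((1 : Fin 2) = 0) = False := eq_false (by decide)
  simp only [Fin.sum_univ_two]
  simp only [Fin.val_zero, Fin.val_one, Matrix.cons_val_zero, Matrix.cons_val_one, f01, f10, if_true, if_false]
  norm_num only [pow_zero, pow_one, mul_one, div_one]
  by_cases hii : i = i'
  · simp only [modeOfIdx, hsgn, if_pos hii, if_pos (congrArg Fin.val hii), Nat.cast_natAbs]
    push_cast
    field_simp
    ring
  · have hii' : (i : ℕ) ≠ (i' : ℕ) := fun h ↦ hii (Fin.ext h)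
    simp only [modeOfIdx, hsgn, hii, hii', if_false]
    push_cast
    field_simp
    ring

end TwistedEncl

end Summit.Ventures.WeilGRH
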